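import Summits.ValiantsHypothesis.ValiantsHypothesis.Theorems.KPlusLogSqLawTropicalBSplitGlue
import Summits.ValiantsHypothesis.ValiantsHypothesis.Theorems.KPlusLogSqLawTropicalExchange

/-!
# Route «KPlusLogSqLaw», crux `TropicalB` (stmt-ValiantsHypothesis-19771) — THE DOCKING LAW: arcs of the exchange cycles of several
# terms over a common base re-assemble into a PRESENT term; rearranged pairs of dominant terms are slope-sandwiched; hence
# single-token activations over a common base never make a PARALLEL DOUBLE CONTACT

HONEST FRAMING.  Helper toward the registered stubs `stub_tropThin` / `stub_tropFat` of `Cruxes/TropicalB/Lines/birth.lean` (crux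
`Summit.ValiantsHypothesis.ValiantsHypothesis.Theses.KPlusLogSqLaw.TropicalB`, item stmt-ValiantsHypothesis-19771, route KPlusLogSqLaw;
cell `pub-symmetroid`, seat val-sym-trop-p5 g25, refuter-adjacent lane, 2026-08-29; `--supports … --as helper`).  STRUCTURE lemmas about
terms and unique optima (`IsDominant`) of an ARBITRARY dominance design `(d, v, ε)` of an arbitrary format `(m, K)`; no support class, no
exponent regime, no sign condition.  Nothing here bounds `TropicalB`, and nothing bears on `WeakLifting`, DoorA26 / DoorA34,
`MatrixDescartes` (stmt-ValiantsHypothesis-18050) or VP ≠ VNP.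

WHY (architecture census of the refuter-adjacent lane).  Every located radix-2 odometer of the cell (the `L`-cubes on `L` nodes,
`…TropicalBBinaryCounters`, `…TropicalBBinaryCounterSix`) activates a token `x` over a state `B` by ONE exchange cycle `Z_x`
(the quotient permutation `σ_B⁻¹ σ_{P_x}` on the columns where `P_x ≠ B`), and two such cycles always MEET (sunflower law,
`…TropicalBDisjointDeviations`).  This file is the next constraint on HOW they may meet.  Write `ρ_P = σ_B⁻¹σ_P` (a column
permutation: `P` puts at column `i` the row that `B` holds at column `ρ_P i`).  A ρ_P-ARC is a column set `A` with an EXIT `x ∈ A`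
and a TERMINAL `t ∈ A` such that `ρ_P` maps `A − x` into `A − t`; if arcs `A_j` of several terms `P_j` over the same base are pairwise
disjoint and the exit of each DOCKS onto the terminal of the next (`ρ_{P_j} x_j = t_{dock j}` for a permutation `dock` of the indices),
then «`P_j` on `A_j`, `B` elsewhere» IS A TERM (`docking`), present when the `P_j` and `B` are.  Two complementary dockings of a pair
`(P, Q)` are a column-wise REARRANGEMENT `(T′, T″)` of `(P, Q)`: every additive weight adds up, `w(T′) + w(T″) = w(P) + w(Q)`.

* `Docking.slope_sandwich` — **REARRANGEMENT SANDWICH**: if `P` is the unique optimum at `θP`, `Q` at `θQ > θP`, and `(T′, T″)` is a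
  column-wise rearrangement of `(P, Q)` with `T′ ∉ {P, Q}`, then `slope P < slope T′ < slope Q` (the parallelogram law of
  `…TropicalBRegisterPairGadget` in exact-sum form, plus equal-slope uniqueness).
* `Docking.docking` — **DOCKING LEMMA** (pure combinatorics of permutations, any finite index type).
* (sequel `…TropicalBParallelContact`, `Docking.no_parallel_double_contact`) — NO PARALLEL DOUBLE CONTACT between two single-token
  activations over a common base: the two complementary dockings of a parallel double contact are a rearrangement whose slopes cannot be
  sandwiched.
This is the exchange-calculus form of the «junction hop identity» behind the death of pairwise-coupled bit networks (trop-p1 g28, located;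
`…TropicalBNoRigidFanout`): at a shared stretch the two crossed continuations cost exactly as much as the two straight ones.

[folklore: alternating-cycle surgery / uncrossing; lower convex hulls.  The packaging is the cell's; no citation exists.]
-/

set_option linter.dupNamespace false
set_option autoImplicit false

namespace Summit.ValiantsHypothesis.ValiantsHypothesis.Theorems.KPlusLogSqLaw

namespace Docking

open Summit.ValiantsHypothesis.ValiantsHypothesis.Theorems.MatrixDescartes.Negative
open Summit.ValiantsHypothesis.ValiantsHypothesis.Theorems.LacunarySymmetroidMatrixDescartes
open Finset
open scoped BigOperators

variable {m K : ℕ}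

/-! ## 1. Column-wise rearrangements of a pair of terms -/

section Rearrange

variable (d : Fin K → ℕ) (v ε : Fin m → Fin m → Fin K → ℤ)
  {P Q T₁ T₂ : Equiv.Perm (Fin m) × (Fin m → Fin K)}
  (hre : ∀ i, (T₁.1 i = P.1 i ∧ T₁.2 i = P.2 i ∧ T₂.1 i = Q.1 i ∧ T₂.2 i = Q.2 i) ∨
    (T₁.1 i = Q.1 i ∧ T₁.2 i = Q.2 i ∧ T₂.1 i = P.1 i ∧ T₂.2 i = P.2 i))
include hre

/-- a column-wise rearrangement preserves the sum of any per-cell weight. [elementary] -/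
theorem sum_add_sum_of_rearrange (f : Fin m → Fin m → Fin K → ℤ) :
    (∑ i, f (T₁.1 i) i (T₁.2 i)) + ∑ i, f (T₂.1 i) i (T₂.2 i) = (∑ i, f (P.1 i) i (P.2 i)) + ∑ i, f (Q.1 i) i (Q.2 i) := by
  rw [← sum_add_distrib, ← sum_add_distrib]
  refine sum_congr rfl fun i _ => ?_
  rcases hre i with ⟨h1, h2, h3, h4⟩ | ⟨h1, h2, h3, h4⟩
  · rw [h1, h2, h3, h4]
  · rw [h1, h2, h3, h4, add_comm]

/-- slopes add up under a column-wise rearrangement. [elementary] -/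
theorem slope_add_slope_of_rearrange : TropicalCensus.slope d T₁ + TropicalCensus.slope d T₂ = TropicalCensus.slope d P + TropicalCensus.slope d Q := by
  unfold TropicalCensus.slope
  exact sum_add_sum_of_rearrange hre fun _ _ l => (d l : ℤ)

/-- tropical weights add up under a column-wise rearrangement, at every slope. [elementary] -/
theorem tropWeight_add_tropWeight_of_rearrange (θ : ℤ) :
    tropWeight d v θ T₁ + tropWeight d v θ T₂ = tropWeight d v θ P + tropWeight d v θ Q := by
  have hs := slope_add_slope_of_rearrange d hre
  have hv := sum_add_sum_of_rearrange hre v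
  rw [TropicalCensus.tropWeight_eq_slope_sub, TropicalCensus.tropWeight_eq_slope_sub, TropicalCensus.tropWeight_eq_slope_sub, TropicalCensus.tropWeight_eq_slope_sub]
  linear_combination θ * hs - hv

/-- a rearrangement of two present terms is present. [elementary] -/
theorem termSign_ne_zero_of_rearrange (hP : termSign ε P ≠ 0) (hQ : termSign ε Q ≠ 0) :
    termSign ε T₁ ≠ 0 ∧ termSign ε T₂ ≠ 0 := by
  rw [termSign_ne_zero_iff] at hP hQ ⊢
  rw [termSign_ne_zero_iff]
  refine ⟨fun i => ?_, fun i => ?_⟩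
  · rcases hre i with ⟨h1, h2, -, -⟩ | ⟨h1, h2, -, -⟩
    · rw [h1, h2]; exact hP i
    · rw [h1, h2]; exact hQ i
  · rcases hre i with ⟨-, -, h3, h4⟩ | ⟨-, -, h3, h4⟩
    · rw [h3, h4]; exact hQ i
    · rw [h3, h4]; exact hP i

/-- in a rearrangement, `T₁ = P` iff `T₂ = Q`. [elementary] -/
theorem eq_iff_eq_of_rearrange : T₁ = P ↔ T₂ = Q := by
  constructor
  · intro h
    subst h
    refine Prod.ext (Equiv.ext fun i => ?_) (funext fun i => ?_)
    · rcases hre i with ⟨-, -, h3, -⟩ | ⟨h1, -, h3, -⟩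
      · exact h3
      · rw [h3, h1]
    · rcases hre i with ⟨-, -, -, h4⟩ | ⟨-, h2, -, h4⟩
      · exact h4
      · rw [h4, h2]
  · intro h
    subst h
    refine Prod.ext (Equiv.ext fun i => ?_) (funext fun i => ?_)
    · rcases hre i with ⟨h1, -, -, -⟩ | ⟨h1, -, h3, -⟩
      · exact h1
      · rw [h1, ← h3]
    · rcases hre i with ⟨-, h2, -, -⟩ | ⟨-, h2, -, h4⟩
      · exact h2
      · rw [h2, ← h4]

/-- in a rearrangement, `T₁ = Q` iff `T₂ = P`. [elementary] -/
theorem eq_iff_eq_of_rearrange' : T₁ = Q ↔ T₂ = P := by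
  constructor
  · intro h
    subst h
    refine Prod.ext (Equiv.ext fun i => ?_) (funext fun i => ?_)
    · rcases hre i with ⟨h1, -, h3, -⟩ | ⟨-, -, h3, -⟩
      · rw [h3, ← h1]
      · exact h3
    · rcases hre i with ⟨-, h2, -, h4⟩ | ⟨-, -, -, h4⟩
      · rw [h4, ← h2]
      · exact h4
  · intro h
    subst h
    refine Prod.ext (Equiv.ext fun i => ?_) (funext fun i => ?_)
    · rcases hre i with ⟨h1, -, h3, -⟩ | ⟨h1, -, -, -⟩
      · rw [h1, ← h3]
      · exact h1
    · rcases hre i with ⟨-, h2, -, h4⟩ | ⟨-, h2, -, -⟩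
      · rw [h2, ← h4]
      · exact h2

/-- **REARRANGEMENT SANDWICH.**  If `P` is the unique optimum at `θP`, `Q` at `θQ > θP`, and `(T₁, T₂)` is a column-wise rearrangement of
`(P, Q)` with `T₁ ≠ P` and `T₁ ≠ Q`, then `slope P < slope T₁ < slope Q` (and the same for `T₂`, by symmetry of the hypothesis).
[folklore: lower convex hulls; the exact-sum form of the parallelogram law] -/
theorem slope_sandwich {θP θQ : ℤ} (hP : IsDominant d v ε θP P) (hQ : IsDominant d v ε θQ Q) (hθ : θP < θQ)
    (h₁ : T₁ ≠ P) (h₂ : T₁ ≠ Q) : TropicalCensus.slope d P < TropicalCensus.slope d T₁ ∧ TropicalCensus.slope d T₁ < TropicalCensus.slope d Q := by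
  obtain ⟨hT₁, hT₂⟩ := termSign_ne_zero_of_rearrange ε hre hP.1 hQ.1
  have h₃ : T₂ ≠ Q := fun h => h₁ ((eq_iff_eq_of_rearrange hre).mpr h)
  have h₄ : T₂ ≠ P := fun h => h₂ ((eq_iff_eq_of_rearrange' hre).mpr h)
  -- the four dominance inequalities
  have i1 := hP.2 T₁ h₁ hT₁
  have i2 := hQ.2 T₂ h₃ hT₂
  have i3 := hP.2 T₂ h₄ hT₂
  have i4 := hQ.2 T₁ h₂ hT₁
  -- weights are affine in θ with slope `slope`
  have aff : ∀ X : Equiv.Perm (Fin m) × (Fin m → Fin K),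
      tropWeight d v θQ X = tropWeight d v θP X + (θQ - θP) * TropicalCensus.slope d X := by
    intro X; rw [TropicalCensus.tropWeight_eq_slope_sub, TropicalCensus.tropWeight_eq_slope_sub]; ring
  have addP := tropWeight_add_tropWeight_of_rearrange d v hre θP
  have hs := slope_add_slope_of_rearrange d hre
  rw [aff T₂, aff Q] at i2
  rw [aff T₁, aff Q] at i4
  have hΔ : (0 : ℤ) ≤ θQ - θP := by linarith
  constructor
  · have key : (θQ - θP) * TropicalCensus.slope d T₂ < (θQ - θP) * TropicalCensus.slope d Q := by linarith
    have := lt_of_mul_lt_mul_left key hΔ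
    linarith
  · have key : (θQ - θP) * TropicalCensus.slope d T₁ < (θQ - θP) * TropicalCensus.slope d Q := by linarith
    exact lt_of_mul_lt_mul_left key hΔ

end Rearrange

/-! ## 2. The docking lemma -/

section Dock

variable {ι : Type*} [Fintype ι] [DecidableEq ι]

/-- **DOCKING LEMMA.**  Let `B` and `P j` (`j : ι`) be terms, `A j` pairwise disjoint column sets, `x j, t j ∈ A j`, such that for every
`i ∈ A j` other than the exit `x j` the `B`-column of the row `(P j).1 i` lies in `A j` and is not the terminal `t j`, while the
`B`-column of the row at the exit is the terminal of the block `dock j` (`dock` a permutation of the indices).  Then there is a term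
carrying `P j`'s (row, class) data on `A j` for every `j` and `B`'s data elsewhere. [folklore: alternating-cycle surgery] -/
theorem docking (B : Equiv.Perm (Fin m) × (Fin m → Fin K)) (P : ι → Equiv.Perm (Fin m) × (Fin m → Fin K))
    (A : ι → Finset (Fin m)) (x t : ι → Fin m) (dock : ι ≃ ι)
    (hdisj : ∀ j j', j ≠ j' → Disjoint (A j) (A j')) (ht : ∀ j, t j ∈ A j)
    (hin : ∀ j, ∀ i ∈ A j, i ≠ x j → B.1.symm ((P j).1 i) ∈ A j ∧ B.1.symm ((P j).1 i) ≠ t j)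
    (hdock : ∀ j, B.1.symm ((P j).1 (x j)) = t (dock j)) :
    ∃ T : Equiv.Perm (Fin m) × (Fin m → Fin K),
      (∀ j, ∀ i ∈ A j, T.1 i = (P j).1 i ∧ T.2 i = (P j).2 i) ∧
      (∀ i, (∀ j, i ∉ A j) → T.1 i = B.1 i ∧ T.2 i = B.2 i) := by
  classical
  -- the block of a column, when it has one, is unique
  have huniq : ∀ {i : Fin m} {j j' : ι}, i ∈ A j → i ∈ A j' → j = j' := by
    intro i j j' h h'
    by_contra hne
    exact Finset.disjoint_left.mp (hdisj j j' hne) h h'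
  have hchoose : ∀ {i : Fin m} {j : ι} (h : ∃ j', i ∈ A j'), i ∈ A j → h.choose = j :=
    fun h hi => huniq h.choose_spec hi
  -- terminals are distinct for distinct blocks
  have htinj : ∀ {j j' : ι}, t j = t j' → j = j' := fun {j j'} h => huniq (ht j) (h ▸ ht j')
  -- the row map of the recombinant
  let r : Fin m → Fin m := fun i => if h : ∃ j, i ∈ A j then (P h.choose).1 i else B.1 i
  have hrA : ∀ {j : ι} {i : Fin m}, i ∈ A j → r i = (P j).1 i := by
    intro j i hi
    have h : ∃ j', i ∈ A j' := ⟨j, hi⟩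
    simp only [r, dif_pos h, hchoose h hi]
  have hrB : ∀ {i : Fin m}, (∀ j, i ∉ A j) → r i = B.1 i := by
    intro i hi
    have h : ¬ ∃ j', i ∈ A j' := fun ⟨j', hj'⟩ => hi j' hj'
    simp only [r, dif_neg h]
  -- where the `B`-columns of the new rows live
  have himg : ∀ {j : ι} {i : Fin m}, i ∈ A j →
      (i ≠ x j ∧ B.1.symm (r i) ∈ A j ∧ B.1.symm (r i) ≠ t j) ∨ (i = x j ∧ B.1.symm (r i) = t (dock j)) := by
    intro j i hi
    rw [hrA hi]
    by_cases hix : i = x j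
    · exact Or.inr ⟨hix, by rw [hix]; exact hdock j⟩
    · exact Or.inl ⟨hix, hin j i hi hix⟩
  have hinj : Function.Injective r := by
    intro i i' hii'
    have hcol : B.1.symm (r i) = B.1.symm (r i') := by rw [hii']
    by_cases hi : ∃ j, i ∈ A j <;> by_cases hi' : ∃ j, i' ∈ A j
    · obtain ⟨j, hj⟩ := hi
      obtain ⟨j', hj'⟩ := hi'
      rcases himg hj with ⟨hix, hmem, hnt⟩ | ⟨hix, heq⟩ <;> rcases himg hj' with ⟨hix', hmem', hnt'⟩ | ⟨hix', heq'⟩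
      · -- both interior: same block, then injectivity of `(P j).1`
        have hjj : j = j' := huniq hmem (hcol ▸ hmem')
        subst hjj
        have h1 := hrA hj
        have h2 := hrA hj'
        exact (P j).1.injective (by rw [← h1, ← h2, hii'])
      · -- interior vs exit
        rw [hcol, heq'] at hmem
        have hjj : j = dock j' := huniq hmem (ht _)
        rw [hcol, heq'] at hnt
        exact absurd (hjj ▸ rfl) hnt
      · rw [← hcol, heq] at hmem'
        have hjj : j' = dock j := huniq hmem' (ht _)
        rw [← hcol, heq] at hnt'
        exact absurd (hjj ▸ rfl) hnt'
      · -- both exits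
        rw [heq, heq'] at hcol
        have hjj : j = j' := dock.injective (htinj hcol)
        subst hjj
        rw [hix, hix']
    · obtain ⟨j, hj⟩ := hi
      have hout : ∀ j', i' ∉ A j' := fun j' h => hi' ⟨j', h⟩
      have hri' : B.1.symm (r i') = i' := by rw [hrB hout]; simp
      rcases himg hj with ⟨-, hmem, -⟩ | ⟨-, heq⟩
      · rw [hcol, hri'] at hmem; exact absurd hmem (hout j)
      · rw [hcol, hri'] at heq; exact absurd (heq ▸ ht (dock j)) (hout (dock j))
    · obtain ⟨j', hj'⟩ := hi'
      have hout : ∀ j, i ∉ A j := fun j h => hi ⟨j, h⟩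
      have hri : B.1.symm (r i) = i := by rw [hrB hout]; simp
      rcases himg hj' with ⟨-, hmem', -⟩ | ⟨-, heq'⟩
      · rw [← hcol, hri] at hmem'; exact absurd hmem' (hout j')
      · rw [← hcol, hri] at heq'; exact absurd (heq' ▸ ht (dock j')) (hout (dock j'))
    · have hout : ∀ j, i ∉ A j := fun j h => hi ⟨j, h⟩
      have hout' : ∀ j, i' ∉ A j := fun j h => hi' ⟨j, h⟩
      rw [hrB hout, hrB hout'] at hii'
      exact B.1.injective hii'
  have hbij : Function.Bijective r := Finite.injective_iff_bijective.mp hinj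
  refine ⟨(Equiv.ofBijective r hbij, fun i => if h : ∃ j, i ∈ A j then (P h.choose).2 i else B.2 i), ?_, ?_⟩
  · intro j i hi
    have h : ∃ j', i ∈ A j' := ⟨j, hi⟩
    refine ⟨?_, ?_⟩
    · show r i = (P j).1 i
      exact hrA hi
    · show (if h : ∃ j, i ∈ A j then (P h.choose).2 i else B.2 i) = (P j).2 i
      rw [dif_pos h, hchoose h hi]
  · intro i hi
    have h : ¬ ∃ j', i ∈ A j' := fun ⟨j', hj'⟩ => hi j' hj'
    refine ⟨?_, ?_⟩
    · show r i = B.1 i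
      exact hrB hi
    · show (if h : ∃ j, i ∈ A j then (P h.choose).2 i else B.2 i) = B.2 i
      rw [dif_neg h]

end Dock

end Docking

end Summit.ValiantsHypothesis.ValiantsHypothesis.Theorems.KPlusLogSqLaw
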